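import Mathlib
import Summits.PneNP.PneNP.Theorems.Nc03AvoidResidualCoreCandStarReductionChains
import Literature.Computability.Complexity.CodeFPFinite
import Literature.Computability.Complexity.CodeFPBudgets
import Literature.Computability.Complexity.CodeFPLists

/-!
# Route Nc03AvoidResidualCore, item `CandStarReduction` (★) — the tangled-surplus solver, V: polynomial time

Helper file for `stmt-PneNP-19963` (sequel of `…CandStarReductionChains`; cell pnp-ideate). `CodeFP`
typing of every program of `…CandStarReductionProgram` from the tree's typed bricks only (tests,
`any`/`all`/`filter`/`find?`/`map`/`flatten` with contexts, `optBind`/`optMap`/`optCases`, the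
bounded fold `CodeFP.foldl` for the chains — the state is a position that is either the start or the
second output of a listed cherry, so its code is bounded by the input (`iterate_fst`,
`snd_snd_fst_lt_of_mem_cherries`) — and the landed span test `Nc03Reduction.codeFP_inSpan`), ending in
**`codeFP_solStar : CodeFP prE (rawE bitE) solStar`**: the ★-solver is ONE polynomial-time program on
raw pure instances.

Restricted-model (NC⁰₃) range-avoidance rung F-N1b of the PneNP frontier ladder (an algorithmic reduction between
two restricted AVOID problems); nothing here bears on P vs NP.
-/

set_option linter.dupNamespace false -- `Summit.PneNP.PneNP.…`: summit = sub-problem name (D-0017 single-conjunct layout)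

namespace Summit.PneNP.PneNP.Theorems.Nc03CandStarRF

open Literature.Computability.Complexity CodeFP Polynomial
open Summit.PneNP.PneNP.Theorems.Nc03Reduction
  (PRaw ETrip enumT inSpan indic searchOut prE tripE etE codeFP_enumT codeFP_M codeFP_N codeFP_trips
    codeFP_indic codeFP_inSpan tripE_injective etE_injective)

/-! ## Codes -/

/-- The code of a cherry `(u, par u, ep u)`. -/
abbrev chE : ℕ × ETrip × ETrip → List Bool := pairE natE (pairE etE etE)

/-- The code of a chain state `(output, colour)`. -/
abbrev stE : ℕ × Bool → List Bool := pairE natE bitE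

variable {α : Type} {eα : α → List Bool}

/-! ## Apexes, tangled outputs, witnesses -/

/-- `isData` is polynomial time. -/
theorem codeFP_isData : CodeFP (pairE tripE natE) bitE (fun q => isData q.1 q.2) :=
  ((natEq.comp ((snd _ _).pair (fst _ _).snd'.fst')).or (natEq.comp ((snd _ _).pair (fst _ _).snd'.snd'))).congr
    fun _ => rfl

/-- `othD` is polynomial time. -/
theorem codeFP_othD : CodeFP (pairE tripE natE) natE (fun q => othD q.1 q.2) :=
  (CodeFP.ite (natEq.comp ((snd _ _).pair (fst _ _).snd'.fst')) (fst _ _).snd'.snd' (fst _ _).snd'.fst').congr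
    fun q => by by_cases h : q.2 = q.1.2.1 <;> simp [othD, h]

/-- `apexB` is polynomial time (context `(pr, c, u)`). -/
theorem codeFP_apexB : CodeFP (pairE prE (pairE natE natE)) bitE (fun q => apexB q.1 q.2.1 q.2.2) := by
  let σE : PRaw × (ℕ × ℕ) → List Bool := pairE prE (pairE natE natE)
  -- inner test, context `((σ, e), e')`
  have hin : CodeFP (pairE (pairE σE etE) etE) bitE (fun z =>
      !decide (z.1.2.1 = z.2.1) && decide (z.1.2.2.1 = z.1.1.2.1) && decide (z.2.2.1 = z.1.1.2.1) &&
        isData z.1.2.2 z.1.1.2.2 && isData z.2.2 z.1.1.2.2) := by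
    have h1 : CodeFP (pairE (pairE σE etE) etE) bitE (fun z => decide (z.1.2.1 = z.2.1)) :=
      natEq.comp ((fst _ _).snd'.fst'.pair (snd _ _).fst')
    have h2 : CodeFP (pairE (pairE σE etE) etE) bitE (fun z => decide (z.1.2.2.1 = z.1.1.2.1)) :=
      natEq.comp ((fst _ _).snd'.snd'.fst'.pair (fst _ _).fst'.snd'.fst')
    have h3 : CodeFP (pairE (pairE σE etE) etE) bitE (fun z => decide (z.2.2.1 = z.1.1.2.1)) :=
      natEq.comp ((snd _ _).snd'.fst'.pair (fst _ _).fst'.snd'.fst')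
    have h4 : CodeFP (pairE (pairE σE etE) etE) bitE (fun z => isData z.1.2.2 z.1.1.2.2) :=
      codeFP_isData.comp ((fst _ _).snd'.snd'.pair (fst _ _).fst'.snd'.snd')
    have h5 : CodeFP (pairE (pairE σE etE) etE) bitE (fun z => isData z.2.2 z.1.1.2.2) :=
      codeFP_isData.comp ((snd _ _).snd'.pair (fst _ _).fst'.snd'.snd')
    exact (((h1.not.and h2).and h3).and h4).and h5
  have hmid : CodeFP (pairE σE etE) bitE (fun y => (enumT y.1.1).any fun e' =>
      !decide (y.2.1 = e'.1) && decide (y.2.2.1 = y.1.2.1) && decide (e'.2.1 = y.1.2.1) &&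
        isData y.2.2 y.1.2.2 && isData e'.2 y.1.2.2) :=
    ((any hin).comp ((CodeFP.id _).pair (codeFP_enumT.comp (fst _ _).fst'))).congr fun _ => rfl
  exact ((any hmid).comp ((CodeFP.id _).pair (codeFP_enumT.comp (fst _ _)))).congr fun _ => rfl

/-- `tangB` is polynomial time. -/
theorem codeFP_tangB : CodeFP (pairE prE etE) bitE (fun q => tangB q.1 q.2) := by
  have hin : CodeFP (pairE (pairE prE etE) etE) bitE (fun z =>
      !decide (z.2.1 = z.1.2.1) && decide (z.2.2.1 = z.1.2.2.1) &&
        (isData z.2.2 z.1.2.2.2.1 || isData z.2.2 z.1.2.2.2.2)) := by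
    have h1 : CodeFP (pairE (pairE prE etE) etE) bitE (fun z => decide (z.2.1 = z.1.2.1)) :=
      natEq.comp ((snd _ _).fst'.pair (fst _ _).snd'.fst')
    have h2 : CodeFP (pairE (pairE prE etE) etE) bitE (fun z => decide (z.2.2.1 = z.1.2.2.1)) :=
      natEq.comp ((snd _ _).snd'.fst'.pair (fst _ _).snd'.snd'.fst')
    have h3 : CodeFP (pairE (pairE prE etE) etE) bitE (fun z => isData z.2.2 z.1.2.2.2.1) :=
      codeFP_isData.comp ((snd _ _).snd'.pair (fst _ _).snd'.snd'.snd'.fst')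
    have h4 : CodeFP (pairE (pairE prE etE) etE) bitE (fun z => isData z.2.2 z.1.2.2.2.2) :=
      codeFP_isData.comp ((snd _ _).snd'.pair (fst _ _).snd'.snd'.snd'.snd')
    exact (h1.not.and h2).and (h3.or h4)
  exact ((any hin).comp ((CodeFP.id _).pair (codeFP_enumT.comp (fst _ _)))).congr fun _ => rfl

/-- `forceW` is polynomial time (context `((pr, u), e)`). -/
theorem codeFP_forceW : CodeFP (pairE (pairE prE natE) etE) bitE (fun q => forceW q.1.1 q.1.2 q.2) := by
  let cE : (PRaw × ℕ) × ETrip → List Bool := pairE (pairE prE natE) etE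
  have ht : CodeFP cE tripE (fun q => q.2.2) := (snd _ _).snd'
  have hu : CodeFP cE natE (fun q => q.1.2) := (fst _ _).snd'
  have hpr : CodeFP cE prE (fun q => q.1.1) := (fst _ _).fst'
  have h1 : CodeFP cE bitE (fun q => isData q.2.2 q.1.2) := codeFP_isData.comp (ht.pair hu)
  have h2 : CodeFP cE bitE (fun q => apexB q.1.1 q.2.2.1 q.1.2) := codeFP_apexB.comp (hpr.pair (ht.fst'.pair hu))
  have ho : CodeFP cE natE (fun q => othD q.2.2 q.1.2) := codeFP_othD.comp (ht.pair hu)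
  have h3 : CodeFP cE bitE (fun q => decide (othD q.2.2 q.1.2 < q.1.2)) := natLt.comp (ho.pair hu)
  have h4 : CodeFP cE bitE (fun q => apexB q.1.1 q.2.2.1 (othD q.2.2 q.1.2)) :=
    codeFP_apexB.comp (hpr.pair (ht.fst'.pair ho))
  exact ((h1.and h2).and (h3.or h4.not)).congr fun _ => rfl

/-- `parOf` is polynomial time. -/
theorem codeFP_parOf : CodeFP (pairE prE natE) (optE etE) (fun q => parOf q.1 q.2) :=
  ((rawFind? codeFP_forceW).comp ((CodeFP.id _).pair (codeFP_enumT.comp (fst _ _)))).congr fun _ => rfl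

/-- `forcedB` is polynomial time. -/
theorem codeFP_forcedB : CodeFP (pairE prE natE) bitE (fun q => forcedB q.1 q.2) :=
  ((optIsSome etE).comp codeFP_parOf).congr fun _ => rfl

/-- `epOf` is polynomial time (context `((pr, u), e)`). -/
theorem codeFP_epOf : CodeFP (pairE (pairE prE natE) etE) (optE etE) (fun q => epOf q.1.1 q.1.2 q.2) := by
  let cE : (PRaw × ℕ) × ETrip → List Bool := pairE (pairE prE natE) etE
  have hin : CodeFP (pairE cE etE) bitE (fun z =>
      !decide (z.2.1 = z.1.2.1) && decide (z.2.2.1 = z.1.2.2.1) && isData z.2.2 z.1.1.2) := by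
    have h1 : CodeFP (pairE cE etE) bitE (fun z => decide (z.2.1 = z.1.2.1)) :=
      natEq.comp ((snd _ _).fst'.pair (fst _ _).snd'.fst')
    have h2 : CodeFP (pairE cE etE) bitE (fun z => decide (z.2.2.1 = z.1.2.2.1)) :=
      natEq.comp ((snd _ _).snd'.fst'.pair (fst _ _).snd'.snd'.fst')
    have h3 : CodeFP (pairE cE etE) bitE (fun z => isData z.2.2 z.1.1.2) :=
      codeFP_isData.comp ((snd _ _).snd'.pair (fst _ _).fst'.snd')
    exact (h1.not.and h2).and h3
  exact ((rawFind? hin).comp ((CodeFP.id _).pair (codeFP_enumT.comp (fst _ _).fst'))).congr fun _ => rfl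

/-- `cherryOf` is polynomial time. -/
theorem codeFP_cherryOf : CodeFP (pairE prE natE) (optE chE) (fun q => cherryOf q.1 q.2) := by
  -- the inner map, context `((pr, u), e)`, item `e'`
  have hmk : CodeFP (pairE (pairE (pairE prE natE) etE) etE) chE (fun z => (z.1.1.2, z.1.2, z.2)) :=
    (fst _ _).fst'.snd'.pair ((fst _ _).snd'.pair (snd _ _))
  have hmap : CodeFP (pairE (pairE prE natE) etE) (optE chE)
      (fun y => (epOf y.1.1 y.1.2 y.2).map fun e' => (y.1.2, y.2, e')) :=
    ((optMap hmk).comp ((CodeFP.id _).pair codeFP_epOf)).congr fun _ => rfl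
  exact ((optBind hmap).comp ((CodeFP.id _).pair codeFP_parOf)).congr fun _ => rfl

/-- `cherries` is polynomial time. -/
theorem codeFP_cherries : CodeFP prE (rawE chE) cherries := by
  have hitem : CodeFP (pairE prE natE) (rawE chE) (fun q => (cherryOf q.1 q.2).toList) :=
    (optToList chE).comp codeFP_cherryOf
  have hmap : CodeFP prE (rawE (rawE chE)) (fun pr => (List.range pr.1).map fun u => (cherryOf pr u).toList) :=
    ((map hitem).comp ((CodeFP.id _).pair (urange.comp codeFP_N))).congr fun _ => rfl
  exact ((flatten chE).comp hmap).congr fun _ => rfl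

/-! ## Chains -/

/-- `pNext` is polynomial time. -/
theorem codeFP_pNext : CodeFP (pairE prE natE) (optE natE) (fun q => pNext q.1 q.2) := by
  have hp : CodeFP (pairE (pairE prE natE) chE) bitE (fun z => decide (z.2.2.1.1 = z.1.2)) :=
    natEq.comp ((snd _ _).snd'.fst'.fst'.pair (fst _ _).snd')
  have hfind : CodeFP (pairE prE natE) (optE chE) (fun q => (cherries q.1).find? fun z => decide (z.2.1.1 = q.2)) :=
    ((rawFind? hp).comp ((CodeFP.id _).pair (codeFP_cherries.comp (fst _ _)))).congr fun _ => rfl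
  have hg : CodeFP (pairE (pairE prE natE) chE) natE (fun z => z.2.2.2.1) := (snd _ _).snd'.snd'.fst'
  exact ((optMap hg).comp ((CodeFP.id _).pair hfind)).congr fun _ => rfl

/-- `chainStep` is polynomial time. -/
theorem codeFP_chainStep : CodeFP (pairE prE stE) stE (fun q => chainStep q.1 q.2) := by
  have hk := optCases (σ := PRaw × (ℕ × Bool)) (eσ := pairE prE stE) (eα := natE) (eδ := stE)
    (k := fun s o => match o with | none => s.2 | some o' => (o', !s.2.2))
    (gnone := fun s => s.2) (gsome := fun t => (t.2, !t.1.2.2)) (snd _ _)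
    ((snd _ _).pair ((fst _ _).snd'.snd').not) (fun _ => rfl) (fun _ _ => rfl)
  exact (hk.comp ((CodeFP.id _).pair (codeFP_pNext.comp ((fst _ _).pair (snd _ _).fst')))).congr fun q => by
    unfold chainStep; rfl

/-- The position of a chain step is the old position or the second output of a listed cherry. -/
theorem chainStep_fst (pr : PRaw) (s : ℕ × Bool) :
    (chainStep pr s).1 = s.1 ∨ ∃ q ∈ cherries pr, (chainStep pr s).1 = q.2.2.1 := by
  cases h : pNext pr s.1 with
  | none => left; rw [chainStep_of_none h]
  | some o' =>
    right
    obtain ⟨q, hq, -, ho'⟩ := exists_of_pNext_eq_some h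
    exact ⟨q, hq, by rw [chainStep_of_some h, ho']⟩

/-- The position along a chain is the start or the second output of a listed cherry. -/
theorem iterate_fst (pr : PRaw) (o : ℕ) (d : Bool) (k : ℕ) :
    ((chainStep pr)^[k] (o, d)).1 = o ∨ ∃ q ∈ cherries pr, ((chainStep pr)^[k] (o, d)).1 = q.2.2.1 := by
  induction k with
  | zero => left; rfl
  | succ k ih =>
    rw [Function.iterate_succ_apply']
    rcases chainStep_fst pr ((chainStep pr)^[k] (o, d)) with h | h
    · rw [h]; exact ih
    · exact Or.inr h

/-- The second output index of a listed cherry is below the number of triples. -/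
theorem snd_snd_fst_lt_of_mem_cherries {pr : PRaw} {q : ℕ × ETrip × ETrip} (hq : q ∈ cherries pr) :
    q.2.2.1 < pr.2.2.length := by
  obtain ⟨u, -, hu⟩ := exists_of_mem_cherries hq
  obtain ⟨-, -, hep⟩ := cherryOf_eq_some hu
  have hmem := List.mem_of_find?_eq_some hep
  unfold enumT at hmem
  have h1 : q.2.2.1 ∈ List.range pr.2.2.length := (List.of_mem_zip hmem).1
  exact List.mem_range.1 h1

/-- `chain` is polynomial time. -/
theorem codeFP_chain : CodeFP (pairE prE natE) stE (fun q => chain q.1 q.2) := by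
  have hpr : CodeFP (pairE (pairE prE natE) (pairE unitE stE)) prE (fun t => t.1.1) := (fst _ _).fst'
  have hst : CodeFP (pairE (pairE prE natE) (pairE unitE stE)) stE (fun t => t.2.2) := (snd _ _).snd'
  have hstep : CodeFP (pairE (pairE prE natE) (pairE unitE stE)) stE (fun t => chainStep t.1.1 t.2.2) :=
    (codeFP_chainStep.comp (hpr.pair hst)).congr fun _ => rfl
  have hinit : CodeFP (pairE prE natE) stE (fun s => (s.2, false)) := (snd _ _).pair (const _ false)
  have h := foldl (σ := PRaw × ℕ) (α := Unit) (β := ℕ × Bool) (eσ := pairE prE natE) (eα := unitE) (eβ := stE)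
    (step := fun s _ st => chainStep s.1 st) (init := fun s => (s.2, false)) hstep hinit (X + 3)
    (fun s l₁ l₂ => by
      obtain ⟨pr, o⟩ := s
      rw [foldl_units_eq_iterate' (chainStep pr) l₁ (o, false), eval_add, eval_X, eval_ofNat]
      set st := (chainStep pr)^[l₁.length] (o, false)
      have hcur : (natE st.1).length ≤ (prE pr).length + (natE o).length := by
        rcases iterate_fst pr o false l₁.length with h | ⟨q, hq, h⟩
        · rw [show st.1 = o from h]; omega
        · rw [show st.1 = q.2.2.1 from h]
          have h1 := snd_snd_fst_lt_of_mem_cherries hq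
          have h2 := length_le_length_rawE tripE pr.2.2
          have h3 := length_natE_le q.2.2.1
          have h4 : (rawE tripE pr.2.2).length ≤ (prE pr).length := by
            simp only [prE, pairE_apply, length_boolPair]; omega
          omega
      simp only [pairE_apply, length_boolPair, bitE, List.length_singleton] at hcur ⊢
      omega)
  refine ((h.comp ((CodeFP.id _).pair (replicateUnit.comp (codeFP_M.comp (fst _ _))))).congr fun q => ?_)
  show (List.replicate q.1.2.1 ()).foldl (fun st _ => chainStep q.1 st) (q.2, false) = chain q.1 q.2
  rw [foldl_units_eq_iterate]; rfl

/-! ## Candidates and the certificate -/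

/-- `covB` is polynomial time. -/
theorem codeFP_covB : CodeFP (pairE prE etE) bitE (fun q => covB q.1 q.2) :=
  (codeFP_tangB.and ((codeFP_forcedB.comp ((fst _ _).pair (snd _ _).snd'.snd'.fst')).or
    (codeFP_forcedB.comp ((fst _ _).pair (snd _ _).snd'.snd'.snd')))).congr fun _ => rfl

/-- `flipB` is polynomial time (context `(pr, k, o)`). -/
theorem codeFP_flipB : CodeFP (pairE prE (pairE natE natE)) bitE (fun q => flipB q.1 q.2.1 q.2.2) := by
  let cE : PRaw × (ℕ × ℕ) → List Bool := pairE prE (pairE natE natE)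
  have h0 : CodeFP cE bitE (fun q => decide (q.2.1 = 0)) := natEq.comp ((snd _ _).fst'.pair (const _ 0))
  have hr1 : CodeFP cE natE (fun q => (chain q.1 q.2.2).1) := (codeFP_chain.comp ((fst _ _).pair (snd _ _).snd')).fst'
  have hr2 : CodeFP cE natE (fun q => (chain q.1 (q.2.1 - 1)).1) :=
    (codeFP_chain.comp ((fst _ _).pair (natSub.comp ((snd _ _).fst'.pair (const _ 1))))).fst'
  exact (h0.not.and (natEq.comp (hr1.pair hr2))).congr fun _ => rfl

/-- `yB` is polynomial time (context `((pr, k), e)`). -/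
theorem codeFP_yB : CodeFP (pairE (pairE prE natE) etE) bitE (fun q => yB q.1.1 q.1.2 q.2) := by
  let cE : (PRaw × ℕ) × ETrip → List Bool := pairE (pairE prE natE) etE
  have hc : CodeFP cE bitE (fun q => covB q.1.1 q.2) := codeFP_covB.comp ((fst _ _).fst'.pair (snd _ _))
  have hcol : CodeFP cE bitE (fun q => (chain q.1.1 q.2.1).2) := (codeFP_chain.comp ((fst _ _).fst'.pair (snd _ _).fst')).snd'
  have hf : CodeFP cE bitE (fun q => flipB q.1.1 q.1.2 q.2.1) :=
    codeFP_flipB.comp ((fst _ _).fst'.pair ((fst _ _).snd'.pair (snd _ _).fst'))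
  exact (hc.and (hcol.xor hf)).congr fun _ => rfl

/-- `betaB` is polynomial time. -/
theorem codeFP_betaB : CodeFP (pairE prE tripE) bitE (fun q => betaB q.1 q.2) := by
  have h0 : CodeFP (pairE prE tripE) bitE (fun q => forcedB q.1 q.2.1) := codeFP_forcedB.comp ((fst _ _).pair (snd _ _).fst')
  have h1 : CodeFP (pairE prE tripE) bitE (fun q => forcedB q.1 q.2.2.1) :=
    codeFP_forcedB.comp ((fst _ _).pair (snd _ _).snd'.fst')
  have h2 : CodeFP (pairE prE tripE) bitE (fun q => forcedB q.1 q.2.2.2) :=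
    codeFP_forcedB.comp ((fst _ _).pair (snd _ _).snd'.snd')
  exact (h0.xor (h1.and h2)).congr fun _ => rfl

/-- `colP` is polynomial time (context `((pr, v), t)`). -/
theorem codeFP_colP : CodeFP (pairE (pairE prE natE) tripE) bitE (fun q => colP q.1.1 q.1.2 q.2) := by
  let cE : (PRaw × ℕ) × (ℕ × ℕ × ℕ) → List Bool := pairE (pairE prE natE) tripE
  have hv : CodeFP cE natE (fun q => q.1.2) := (fst _ _).snd'
  have hpr : CodeFP cE prE (fun q => q.1.1) := (fst _ _).fst'
  have hc : CodeFP cE natE (fun q => q.2.1) := (snd _ _).fst'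
  have ha : CodeFP cE natE (fun q => q.2.2.1) := (snd _ _).snd'.fst'
  have hb : CodeFP cE natE (fun q => q.2.2.2) := (snd _ _).snd'.snd'
  have fc : CodeFP cE bitE (fun q => forcedB q.1.1 q.2.1) := codeFP_forcedB.comp (hpr.pair hc)
  have fa : CodeFP cE bitE (fun q => forcedB q.1.1 q.2.2.1) := codeFP_forcedB.comp (hpr.pair ha)
  have fb : CodeFP cE bitE (fun q => forcedB q.1.1 q.2.2.2) := codeFP_forcedB.comp (hpr.pair hb)
  have e1 : CodeFP cE bitE (fun q => decide (q.1.2 = q.2.1)) := natEq.comp (hv.pair hc)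
  have e2 : CodeFP cE bitE (fun q => decide (q.1.2 = q.2.2.2)) := natEq.comp (hv.pair hb)
  have e3 : CodeFP cE bitE (fun q => decide (q.1.2 = q.2.2.1)) := natEq.comp (hv.pair ha)
  exact (((e1.and fc.not).or ((e2.and fa).and fb.not)).or ((e3.and fb).and fa.not)).congr fun _ => rfl

/-- `colV` is polynomial time. -/
theorem codeFP_colV : CodeFP (pairE prE natE) (rawE natE) (fun q => colV q.1 q.2) := by
  have hp : CodeFP (pairE (pairE prE natE) etE) bitE (fun z => covB z.1.1 z.2 && colP z.1.1 z.1.2 z.2.2) :=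
    (codeFP_covB.comp ((fst _ _).fst'.pair (snd _ _))).and (codeFP_colP.comp ((fst _ _).pair (snd _ _).snd'))
  have hf : CodeFP (pairE prE natE) (rawE etE)
      (fun q => (enumT q.1).filter fun z => covB q.1 z && colP q.1 q.2 z.2) :=
    ((filter hp).comp ((CodeFP.id _).pair (codeFP_enumT.comp (fst _ _)))).congr fun _ => rfl
  exact ((map₀ (fst natE tripE)).comp hf).congr fun _ => rfl

/-- `cols` is polynomial time. -/
theorem codeFP_cols : CodeFP prE (rawE (rawE natE)) cols :=
  ((map codeFP_colV).comp ((CodeFP.id _).pair (urange.comp codeFP_N))).congr fun _ => rfl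

/-- `ySet` is polynomial time. -/
theorem codeFP_ySet : CodeFP (pairE prE natE) (rawE natE) (fun q => ySet q.1 q.2) := by
  have hf : CodeFP (pairE prE natE) (rawE etE) (fun q => (enumT q.1).filter fun z => yB q.1 q.2 z) :=
    ((filter codeFP_yB).comp ((CodeFP.id _).pair (codeFP_enumT.comp (fst _ _)))).congr fun _ => rfl
  exact ((map₀ (fst natE tripE)).comp hf).congr fun _ => rfl

/-- `tgt` is polynomial time. -/
theorem codeFP_tgt : CodeFP (pairE prE natE) (rawE natE) (fun q => tgt q.1 q.2) := by
  have hp : CodeFP (pairE (pairE prE natE) etE) bitE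
      (fun z => xor (yB z.1.1 z.1.2 z.2) (covB z.1.1 z.2 && betaB z.1.1 z.2.2)) :=
    codeFP_yB.xor ((codeFP_covB.comp ((fst _ _).fst'.pair (snd _ _))).and
      (codeFP_betaB.comp ((fst _ _).fst'.pair (snd _ _).snd')))
  have hf : CodeFP (pairE prE natE) (rawE etE)
      (fun q => (enumT q.1).filter fun z => xor (yB q.1 q.2 z) (covB q.1 z && betaB q.1 z.2)) :=
    ((filter hp).comp ((CodeFP.id _).pair (codeFP_enumT.comp (fst _ _)))).congr fun _ => rfl
  exact ((map₀ (fst natE tripE)).comp hf).congr fun _ => rfl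

/-- `consOK` is polynomial time. -/
theorem codeFP_consOK : CodeFP (pairE prE natE) bitE (fun q => consOK q.1 q.2) := by
  have hp : CodeFP (pairE (pairE prE natE) chE) bitE (fun z => xor (yB z.1.1 z.1.2 z.2.2.1) (yB z.1.1 z.1.2 z.2.2.2)) :=
    (codeFP_yB.comp ((fst _ _).pair (snd _ _).snd'.fst')).xor (codeFP_yB.comp ((fst _ _).pair (snd _ _).snd'.snd'))
  exact ((all hp).comp ((CodeFP.id _).pair (codeFP_cherries.comp (fst _ _)))).congr fun _ => rfl

/-- `testC` is polynomial time. -/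
theorem codeFP_testC : CodeFP (pairE prE natE) bitE (fun q => testC q.1 q.2) := by
  have hs : CodeFP (pairE prE natE) bitE (fun q => inSpan q.1.2.1 (cols q.1) (tgt q.1 q.2)) :=
    codeFP_inSpan.comp ((codeFP_M.comp (fst _ _)).pair ((codeFP_cols.comp (fst _ _)).pair codeFP_tgt))
  exact (codeFP_consOK.and hs.not).congr fun _ => rfl

/-- Search-and-indicate with a context-dependent test AND read-off is polynomial time. -/
theorem codeFP_searchOutCtx₂ {cands : PRaw → List α} {test : PRaw × α → Bool} {readOff : PRaw × α → List ℕ}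
    (hc : CodeFP prE (rawE eα) cands) (ht : CodeFP (pairE prE eα) bitE test)
    (hr : CodeFP (pairE prE eα) (rawE natE) readOff) :
    CodeFP prE (rawE bitE)
      (fun pr => searchOut pr.2.1 (((cands pr).find? fun x => test (pr, x)).map fun x => readOff (pr, x))) := by
  have hfind : CodeFP prE (optE eα) (fun pr => (cands pr).find? fun x => test (pr, x)) :=
    (rawFind? (σ := PRaw) (eσ := prE) (p := test) ht).comp ((CodeFP.id prE).pair hc)
  have hmap : CodeFP prE (optE (rawE natE))
      (fun pr => ((cands pr).find? fun x => test (pr, x)).map fun x => readOff (pr, x)) :=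
    (optMap (σ := PRaw) (eσ := prE) (g := readOff) hr).comp ((CodeFP.id prE).pair hfind)
  have hk := optCases (σ := PRaw) (eσ := prE) (eα := rawE natE) (eδ := rawE bitE)
    (k := fun pr o => searchOut pr.2.1 o)
    (gnone := fun pr => indic pr.2.1 []) (gsome := fun t => indic t.1.2.1 t.2)
    (codeFP_indic.comp (codeFP_M.pair (const prE ([] : List ℕ))))
    (codeFP_indic.comp ((codeFP_M.comp (fst _ _)).pair (snd _ _)))
    (fun _ => rfl) (fun _ _ => rfl)
  exact (hk.comp ((CodeFP.id prE).pair hmap)).congr fun _ => rfl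

/-- **The ★-solver is polynomial time.** -/
theorem codeFP_solStar : CodeFP prE (rawE bitE) solStar := by
  have hc : CodeFP prE (rawE natE) (fun pr => List.range (pr.2.1 + 1)) := urange.comp (unSucc.comp codeFP_M)
  exact (codeFP_searchOutCtx₂ hc codeFP_testC codeFP_ySet).congr fun pr => by unfold solStar; rfl

end Summit.PneNP.PneNP.Theorems.Nc03CandStarRF
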